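import Literature.MathematicalPhysics.QuantumLattice.LiebWuNeumannSeries
import Literature.MathematicalPhysics.QuantumLattice.LiebWuHalfFilledInstance
import Literature.MathematicalPhysics.QuantumLattice.LiebWuIntegralEquationsUniqueness
import HarnessLib

/-!
# Existence of the `B = ∞` solution of the Lieb–Wu integral equations (Lieb–Wu 2003, Theorem 1)

Family `hubbard`. Lieb–Wu, PRL 20 (1968) 1445, statement (a): "Equations (13)–(16) have a unique
solution which is positive for all allowed `B` and `Q`" = Lieb–Wu, Physica A 321 (2003) 1, §5,
THEOREM 1. The file `LiebWuNeumannSeries` constructs, for `U > 0` and `0 < Q`, the positive continuous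
integrable solution `σ = liebWuSigmaAt U Q = Σ Ŵⁿξ` of the fixed-point form (S) of the `σ`-equation at
`B = ∞`, `σ = ξ + Ŵσ`. This file translates the fixed point BACK into the printed equations: with
`ρ(k) = 1/2π + cos k · (σ ∗ K_{U/4})(sin k)` (eq. (13) taken as the definition of `ρ`, `liebWuRhoAt`),
the pair `(ρ, σ)` satisfies (14) on all of `ℝ`, i.e.

* `isLiebWuDensities_liebWuRhoAt_liebWuSigmaAt`: `IsLiebWuDensities U Q univ ρ σ` for every `U > 0`,
  `0 < Q ≤ π` — the EXISTENCE clause of Theorem 1 at `B = ∞`, with `σ > 0` (`liebWuSigmaAt_pos`);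
* `exists_isLiebWuGroundStateDensities`, and `isLiebWuEnergyAt_liebWuRhoAt`: the energy (17) of this
  solution is a value of `IsLiebWuEnergyAt U (liebWuFilling Q ρ)`.

With `LiebWuIntegralEquationsUniqueness` (uniqueness at `B = ∞`): EVERY `B = ∞` solution with cutoff `Q`
is this one (`IsLiebWuDensities.sigma_eq_liebWuSigmaAt`, `.rho_eq_liebWuRhoAt`), so its filling and energy
are `liebWuFilling Q (liebWuRhoAt U Q)`, `liebWuEnergyPerSite Q (liebWuRhoAt U Q)`, and
`IsLiebWuEnergyAt U n e ↔ ∃ Q ∈ (0, π], n, e are these values` (`isLiebWuEnergyAt_iff`; as functions of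
the cutoff: `liebWuFillingAtCutoff`, `liebWuEnergyAtCutoff`). At `Q = π` the solution is the closed form
(18)–(19) (`liebWuSigmaAt_pi`, `liebWuRhoAt_pi`), the filling is `1` and the energy is `liebWuEnergy U`,
eq. (20) (`liebWuFillingAtCutoff_pi`, `liebWuEnergyAtCutoff_pi`). This is statement (a) of the PRL at
`B = ∞` except for the positivity of `ρ` on `[-Q, Q]` (Lieb–Wu 2003, Lemma 3), not treated.

## Proof ("applying `1 + K̂²`" to (S); Lieb–Wu 2003, §5, between eqs. (S) and (R))

With `G = σ ∗ K`, `A = 1_{(-a,a]}`, `a = sin Q`: `Ŵσ = ½ (AG) ∗ r` and `ξ = ¼π⁻¹ ∫_{-Q}^{Q} r(· - sin k) dk`.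
The kernel identity `r ∗ K² = 2K - r` (`integral_sechKernel_mul_cauchyDensity_two_mul`) gives
`ξ ∗ K² = S - ξ` with `S = (2π)⁻¹ ∫_{-Q}^{Q} K(· - sin k) dk`, and `(Ŵσ) ∗ K² = (AG) ∗ K - Ŵσ`; hence
`σ + σ ∗ K² = S + (AG) ∗ K`, and `S + (AG) ∗ K = ∫_{-Q}^{Q} K(Λ - sin k) ρ(k) dk` by the substitution
`x = sin k` — which is (14) at `B = ∞`.

## References

* E. H. Lieb, F. Y. Wu, Physica A 321 (2003) 1–27 = arXiv:cond-mat/0207529, §5, Theorem 1, eqs. (S),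
  (R), (W), (series) (key `LiebWuPhysicaA2003`); PRL 20 (1968) 1445, statement (a) (`LiebWuPRL1968`).
-/

noncomputable section

open MeasureTheory Set Real Filter intervalIntegral
open Literature.Analysis.SpecialFunctions Literature.Analysis.FunctionSpaces
open scoped Convolution Topology

namespace Literature.MathematicalPhysics.QuantumLattice

namespace LiebWuExistence

variable {f g k : ℝ → ℝ} {B B' : ℝ}

/-- `t ↦ f(t) g(x - t)` is integrable for `f ∈ L¹`, `g` bounded continuous. [folklore] -/
private theorem integrable_mul_sub (hf : Integrable f) (hgc : Continuous g) (hgB : ∀ y, |g y| ≤ B)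
    (x : ℝ) : Integrable fun t => f t * g (x - t) :=
  hf.mul_bdd (hgc.comp (continuous_const.sub continuous_id)).aestronglyMeasurable
    (Eventually.of_forall fun t => by rw [Real.norm_eq_abs]; exact hgB _)

/-- `x ↦ ∫ f(t) g(x - t) dt` is continuous for `f ∈ L¹`, `g` bounded continuous. [folklore] -/
private theorem continuous_conv (hf : Integrable f) (hgc : Continuous g) (hgB : ∀ y, |g y| ≤ B) :
    Continuous fun x => ∫ t, f t * g (x - t) := by
  have h : (fun x => ∫ t, f t * g (x - t)) = f ⋆[ContinuousLinearMap.mul ℝ ℝ, volume] g := by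
    funext x; rw [convolution_def]; simp only [ContinuousLinearMap.mul_apply']
  rw [h]
  refine BddAbove.continuous_convolution_right_of_integrable (L := ContinuousLinearMap.mul ℝ ℝ)
    ⟨B, ?_⟩ hf hgc
  rintro _ ⟨y, rfl⟩
  exact (Real.norm_eq_abs _).trans_le (hgB y)

/-- Linearity of `g ↦ ∫ f(t) g(x - t) dt`. [folklore] -/
private theorem conv_sub_right (hf : Integrable f) (hgc : Continuous g) (hgB : ∀ y, |g y| ≤ B)
    (hkc : Continuous k) (hkB : ∀ y, |k y| ≤ B') (x : ℝ) :
    ∫ t, f t * (g (x - t) - k (x - t)) = (∫ t, f t * g (x - t)) - ∫ t, f t * k (x - t) := by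
  rw [← integral_sub (integrable_mul_sub hf hgc hgB x) (integrable_mul_sub hf hkc hkB x)]
  refine MeasureTheory.integral_congr_ae (Eventually.of_forall fun t => ?_)
  ring

/-- Associativity `((f ∗ g) ∗ k)(x) = (f ∗ (g ∗ k))(x)` for `f, g ∈ L¹`, `k` bounded continuous. [folklore] -/
private theorem conv_conv (hf : Integrable f) (hgi : Integrable g) (hkc : Continuous k)
    (hkB : ∀ y, |k y| ≤ B') (x : ℝ) :
    ∫ y, (∫ z, f z * g (y - z)) * k (x - y) = ∫ z, f z * ∫ s, g s * k (x - z - s) := by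
  have hprod : Integrable (fun p : ℝ × ℝ => f p.2 * g (p.1 - p.2))
      ((volume : Measure ℝ).prod volume) :=
    hf.convolution_integrand (ContinuousLinearMap.mul ℝ ℝ) hgi
  have hkm : Continuous fun p : ℝ × ℝ => k (x - p.1) := hkc.comp (continuous_const.sub continuous_fst)
  have h := hprod.mul_bdd (c := B') hkm.aestronglyMeasurable
    (Eventually.of_forall fun p => by rw [Real.norm_eq_abs]; exact hkB _)
  have hF : Integrable (Function.uncurry fun y z => f z * g (y - z) * k (x - y))
      ((volume : Measure ℝ).prod volume) := h
  calc ∫ y, (∫ z, f z * g (y - z)) * k (x - y) = ∫ y, ∫ z, f z * g (y - z) * k (x - y) := by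
        refine MeasureTheory.integral_congr_ae (Eventually.of_forall fun y => ?_)
        exact (MeasureTheory.integral_mul_const (k (x - y)) _).symm
    _ = ∫ z, ∫ y, f z * g (y - z) * k (x - y) := integral_integral_swap hF
    _ = ∫ z, f z * ∫ s, g s * k (x - z - s) := by
        refine MeasureTheory.integral_congr_ae (Eventually.of_forall fun z => ?_)
        dsimp only
        rw [← MeasureTheory.integral_const_mul,
          ← integral_add_right_eq_self (fun y => f z * g (y - z) * k (x - y)) z]
        refine MeasureTheory.integral_congr_ae (Eventually.of_forall fun s => ?_)
        dsimp only
        rw [add_sub_cancel_right, show x - (s + z) = x - z - s by ring]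
        ring

end LiebWuExistence

open LiebWuExistence

/-- **The momentum density of the `B = ∞` solution**, defined by eq. (13) from `σ = liebWuSigmaAt U Q`:
`ρ(k) = 1/2π + cos k · ∫ σ(t) K_{U/4}(sin k - t) dt`. [cite: LiebWuPhysicaA2003, §4, boxed equation for ρ] -/
def liebWuRhoAt (U Q k : ℝ) : ℝ :=
  1 / (2 * π) + Real.cos k * ∫ t, liebWuSigmaAt U Q t * cauchyDensity (U / 4) (Real.sin k - t)

section Existence

variable {U Q : ℝ}

/-- `ρ` is continuous. [cite: LiebWuPhysicaA2003, §5, Theorem 1] -/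
theorem continuous_liebWuRhoAt (hU : 0 < U) (hQ : 0 < Q) : Continuous (liebWuRhoAt U Q) := by
  have hc : 0 < U / 4 := by positivity
  have hG : Continuous fun x => ∫ t, liebWuSigmaAt U Q t * cauchyDensity (U / 4) (x - t) :=
    continuous_conv (integrable_liebWuSigmaAt hU hQ) (continuous_cauchyDensity hc)
      (fun y => by rw [abs_of_pos (cauchyDensity_pos hc y)]; exact cauchyDensity_le hc y)
  unfold liebWuRhoAt
  exact continuous_const.add (Real.continuous_cos.mul (hG.comp Real.continuous_sin))

/-- **Lieb–Wu 2003, Theorem 1 (existence), case `B = ∞`.** For `U > 0` and `0 < Q ≤ π` the Neumann-series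
pair `(ρ, σ) = (liebWuRhoAt U Q, liebWuSigmaAt U Q)` is an `L¹` solution of the Lieb–Wu equations (13)–(14)
with momentum cutoff `Q` and rapidity range `ℝ`. [cite: LiebWuPhysicaA2003, §5, Theorem 1] -/
theorem isLiebWuDensities_liebWuRhoAt_liebWuSigmaAt (hU : 0 < U) (hQ : 0 < Q) (hQπ : Q ≤ π) :
    IsLiebWuDensities U Q univ (liebWuRhoAt U Q) (liebWuSigmaAt U Q) := by
  have hc : 0 < U / 4 := by positivity
  have h2c : 0 < 2 * (U / 4) := by positivity
  have hU2 : U / 2 = 2 * (U / 4) := by ring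
  -- kernels and their bounds
  have hKc : Continuous (cauchyDensity (U / 4)) := continuous_cauchyDensity hc
  have hKB : ∀ y, |cauchyDensity (U / 4) y| ≤ 1 / (π * (U / 4)) := fun y => by
    rw [abs_of_pos (cauchyDensity_pos hc y)]; exact cauchyDensity_le hc y
  have hK2c : Continuous (cauchyDensity (2 * (U / 4))) := continuous_cauchyDensity h2c
  have hK2i : Integrable (cauchyDensity (2 * (U / 4))) := integrable_cauchyDensity h2c.le
  have hK2B : ∀ y, |cauchyDensity (2 * (U / 4)) y| ≤ 1 / (π * (2 * (U / 4))) := fun y => by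
    rw [abs_of_pos (cauchyDensity_pos h2c y)]; exact cauchyDensity_le h2c y
  have hrc : Continuous (sechKernel (U / 4)) := continuous_sechKernel hc
  have hri : Integrable (sechKernel (U / 4)) := integrable_sechKernel hc
  have hrB : ∀ y, |sechKernel (U / 4) y| ≤ 1 / (2 * (U / 4)) := fun y => by
    rw [abs_of_pos (sechKernel_pos hc y)]; exact sechKernel_le hc y
  -- `σ`, `G = σ ∗ K`, `AG = 1_{(-a,a]} G`
  set σ : ℝ → ℝ := liebWuSigmaAt U Q with hσ
  have hσi : Integrable σ := integrable_liebWuSigmaAt hU hQ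
  set G : ℝ → ℝ := fun x => ∫ t, σ t * cauchyDensity (U / 4) (x - t) with hG
  have hGc : Continuous G := continuous_conv hσi hKc hKB
  set a : ℝ := Real.sin Q with ha
  have ha0 : 0 ≤ a := Real.sin_nonneg_of_nonneg_of_le_pi hQ.le hQπ
  set AG : ℝ → ℝ := (Ioc (-a) a).indicator G with hAG
  have hAGi : Integrable AG := by
    rw [hAG, integrable_indicator_iff measurableSet_Ioc]
    exact (hGc.integrableOn_Icc).mono_set Ioc_subset_Icc_self
  -- `Ŵσ = ½ AG ∗ r` and the fixed point
  have hW : ∀ x, liebWuW U Q σ x = 1 / 2 * ∫ t, AG t * sechKernel (U / 4) (x - t) := by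
    intro x
    rw [liebWuW]
    congr 1
    refine MeasureTheory.integral_congr_ae (Eventually.of_forall fun t => ?_)
    beta_reduce
    by_cases ht : t ∈ Ioc (-a) a
    · rw [indicator_of_mem ht, hAG, indicator_of_mem ht, one_mul]
    · rw [indicator_of_notMem ht, hAG, indicator_of_notMem ht, zero_mul, zero_mul]
  have hfix : ∀ x, σ x = liebWuXi U Q x + 1 / 2 * ∫ t, AG t * sechKernel (U / 4) (x - t) :=
    fun x => by rw [← hW x]; exact liebWuSigmaAt_eq_xi_add_W hU hQ x
  -- the measure `dk|_{(-Q,Q]}` and the two averages `S = K ⋄ m /2π`, `ξ = r ⋄ m /4π`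
  set m : Measure ℝ := volume.restrict (Ioc (-Q) Q) with hm
  haveI : IsFiniteMeasure m := by rw [hm]; infer_instance
  have hξ : ∀ x, liebWuXi U Q x = 1 / (4 * π) * ∫ k, sechKernel (U / 4) (x - Real.sin k) ∂m :=
    fun x => congrFun (liebWuXi_eq_integral_restrict hQ U) x
  -- (a) `ξ ∗ K² = S - ξ`
  have hξK2 : ∀ Λ, ∫ t, liebWuXi U Q t * cauchyDensity (2 * (U / 4)) (Λ - t) =
      (1 / (2 * π) * ∫ k, cauchyDensity (U / 4) (Λ - Real.sin k) ∂m) - liebWuXi U Q Λ := by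
    intro Λ
    have hfun : (fun t => liebWuXi U Q t * cauchyDensity (2 * (U / 4)) (Λ - t)) = fun t =>
        1 / (4 * π) * (cauchyDensity (2 * (U / 4)) (Λ - t) *
          ∫ k, sechKernel (U / 4) (t - Real.sin k) ∂m) := by
      funext t; rw [hξ t]; ring
    rw [hfun, MeasureTheory.integral_const_mul,
      integral_mul_integral_comp_sub (m := m) hrc hri Real.continuous_sin
        (h := fun y => cauchyDensity (2 * (U / 4)) (Λ - y))
        (hK2c.comp (continuous_const.sub continuous_id)) (fun y => hK2B (Λ - y))]
    have hinner : ∀ k, ∫ t, cauchyDensity (2 * (U / 4)) (Λ - t) * sechKernel (U / 4) (t - Real.sin k) =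
        2 * cauchyDensity (U / 4) (Λ - Real.sin k) - sechKernel (U / 4) (Λ - Real.sin k) := by
      intro k
      rw [integral_mul_comp_sub_translate (cauchyDensity (2 * (U / 4))) (sechKernel (U / 4)) Λ (Real.sin k),
        integral_sechKernel_mul_cauchyDensity_two_mul hc]
    simp_rw [hinner]
    have hiK : Integrable (fun k => 2 * cauchyDensity (U / 4) (Λ - Real.sin k)) m :=
      integrable_of_continuous_of_abs_le (continuous_const.mul (hKc.comp
        (continuous_const.sub Real.continuous_sin))) (B := 2 * (1 / (π * (U / 4)))) fun k => by
          rw [abs_mul, abs_of_pos (by norm_num : (0 : ℝ) < 2)]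
          exact mul_le_mul_of_nonneg_left (hKB _) (by norm_num)
    have hir : Integrable (fun k => sechKernel (U / 4) (Λ - Real.sin k)) m :=
      integrable_of_continuous_of_abs_le (hrc.comp (continuous_const.sub Real.continuous_sin))
        fun k => hrB _
    rw [integral_sub hiK hir, MeasureTheory.integral_const_mul, hξ Λ]
    ring
  -- (b) `(AG ∗ r) ∗ K² = 2 AG ∗ K - AG ∗ r`
  have hAGrK2 : ∀ Λ, ∫ y, (∫ z, AG z * sechKernel (U / 4) (y - z)) * cauchyDensity (2 * (U / 4)) (Λ - y) =
      2 * (∫ z, AG z * cauchyDensity (U / 4) (Λ - z)) - ∫ z, AG z * sechKernel (U / 4) (Λ - z) := by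
    intro Λ
    rw [conv_conv hAGi hri hK2c hK2B]
    have hin : ∀ z, ∫ s, sechKernel (U / 4) s * cauchyDensity (2 * (U / 4)) (Λ - z - s) =
        2 * cauchyDensity (U / 4) (Λ - z) - sechKernel (U / 4) (Λ - z) := fun z =>
      integral_sechKernel_mul_cauchyDensity_two_mul hc (Λ - z)
    simp_rw [hin]
    rw [conv_sub_right hAGi (g := fun y => 2 * cauchyDensity (U / 4) y) (continuous_const.mul hKc)
      (B := 2 * (1 / (π * (U / 4))))
      (fun y => by rw [abs_mul, abs_of_pos (by norm_num : (0 : ℝ) < 2)]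
                   exact mul_le_mul_of_nonneg_left (hKB y) (by norm_num)) hrc hrB,
      ← MeasureTheory.integral_const_mul]
    congr 1
    refine MeasureTheory.integral_congr_ae (Eventually.of_forall fun z => ?_)
    ring
  -- (c) `σ ∗ K² = S + AG ∗ K - σ` (from the fixed point and (a), (b))
  have hσK2 : ∀ Λ, ∫ t, σ t * cauchyDensity (2 * (U / 4)) (Λ - t) =
      (1 / (2 * π) * ∫ k, cauchyDensity (U / 4) (Λ - Real.sin k) ∂m) +
        (∫ z, AG z * cauchyDensity (U / 4) (Λ - z)) - σ Λ := by
    intro Λ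
    have hsplit : (fun t => σ t * cauchyDensity (2 * (U / 4)) (Λ - t)) = fun t =>
        liebWuXi U Q t * cauchyDensity (2 * (U / 4)) (Λ - t) +
          1 / 2 * ((∫ z, AG z * sechKernel (U / 4) (t - z)) * cauchyDensity (2 * (U / 4)) (Λ - t)) := by
      funext t; rw [hfix t]; ring
    have hi1 : Integrable fun t => liebWuXi U Q t * cauchyDensity (2 * (U / 4)) (Λ - t) :=
      integrable_mul_sub (integrable_liebWuXi_and_integral hU hQ).1 hK2c hK2B Λ
    have hi2 : Integrable fun t => (∫ z, AG z * sechKernel (U / 4) (t - z)) *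
        cauchyDensity (2 * (U / 4)) (Λ - t) := by
      have h := (hAGi.integrable_convolution (ContinuousLinearMap.mul ℝ ℝ) hri)
      have h' : Integrable fun t => ∫ z, AG z * sechKernel (U / 4) (t - z) := by
        refine h.congr (Eventually.of_forall fun t => ?_)
        rw [convolution_def]; simp only [ContinuousLinearMap.mul_apply']
      exact integrable_mul_sub h' hK2c hK2B Λ
    rw [hsplit, integral_add hi1 (hi2.const_mul _), MeasureTheory.integral_const_mul, hξK2 Λ, hAGrK2 Λ,
      hfix Λ]
    ring
  -- (d) the `k`-integral of (14): `∫_{-Q}^{Q} K(Λ - sin k) ρ(k) dk = S + AG ∗ K` (substitution `x = sin k`)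
  have hT : ∀ Λ, ∫ k in -Q..Q, cauchyDensity (U / 4) (Λ - Real.sin k) * liebWuRhoAt U Q k =
      (1 / (2 * π) * ∫ k, cauchyDensity (U / 4) (Λ - Real.sin k) ∂m) +
        ∫ z, AG z * cauchyDensity (U / 4) (Λ - z) := by
    intro Λ
    have hKs : Continuous fun k => cauchyDensity (U / 4) (Λ - Real.sin k) := by fun_prop
    have hg : Continuous fun x => cauchyDensity (U / 4) (Λ - x) * G x := by fun_prop
    have hsub := intervalIntegral.integral_comp_mul_deriv (a := -Q) (b := Q)
      (fun k _ => Real.hasDerivAt_sin k) Real.continuous_cos.continuousOn hg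
    rw [Real.sin_neg, ← ha] at hsub
    have hρ : ∀ k, cauchyDensity (U / 4) (Λ - Real.sin k) * liebWuRhoAt U Q k =
        1 / (2 * π) * cauchyDensity (U / 4) (Λ - Real.sin k) +
          ((fun x => cauchyDensity (U / 4) (Λ - x) * G x) ∘ Real.sin) k * Real.cos k := by
      intro k
      simp only [liebWuRhoAt, Function.comp_apply, hG, hσ]
      ring
    simp_rw [hρ]
    have hi1 : IntervalIntegrable (fun k => 1 / (2 * π) * cauchyDensity (U / 4) (Λ - Real.sin k))
        volume (-Q) Q := (continuous_const.mul hKs).intervalIntegrable _ _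
    have hi2 : IntervalIntegrable (fun k => ((fun x => cauchyDensity (U / 4) (Λ - x) * G x) ∘ Real.sin) k *
        Real.cos k) volume (-Q) Q := ((hg.comp Real.continuous_sin).mul Real.continuous_cos).intervalIntegrable _ _
    rw [intervalIntegral.integral_add hi1 hi2, intervalIntegral.integral_const_mul, hsub,
      intervalIntegral.integral_of_le (by linarith : -a ≤ a),
      ← MeasureTheory.integral_indicator (measurableSet_Ioc : MeasurableSet (Ioc (-a) a)),
      intervalIntegral.integral_of_le (by linarith : -Q ≤ Q), hm]
    congr 1
    refine MeasureTheory.integral_congr_ae (Eventually.of_forall fun t => ?_)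
    beta_reduce
    by_cases ht : t ∈ Ioc (-a) a
    · rw [indicator_of_mem ht, hAG, indicator_of_mem ht]; ring
    · rw [indicator_of_notMem ht, hAG, indicator_of_notMem ht, zero_mul]
  -- assemble via the kernel-form constructor
  refine IsLiebWuDensities.of_kernel_form hQ hQπ (Or.inr rfl)
    ((continuous_liebWuRhoAt hU hQ).intervalIntegrable _ _) hσi.integrableOn (fun k _ => ?_) (fun Λ _ => ?_)
  · rw [Measure.restrict_univ, liebWuRhoAt]
    congr 2
    exact MeasureTheory.integral_congr_ae (Eventually.of_forall fun t => mul_comm _ _)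
  · rw [Measure.restrict_univ, hT Λ, hU2]
    have hcomm : ∫ Λ', cauchyDensity (2 * (U / 4)) (Λ - Λ') * liebWuSigmaAt U Q Λ' =
        ∫ t, σ t * cauchyDensity (2 * (U / 4)) (Λ - t) :=
      MeasureTheory.integral_congr_ae (Eventually.of_forall fun t => mul_comm _ _)
    rw [hcomm, hσK2 Λ]
    ring

/-- **Existence of the absolute-ground-state densities** (statement (a) at `B = ∞`): for `U > 0` and
`0 < Q ≤ π` there is a solution of (13)–(14) with rapidity range `ℝ`, with `σ > 0` everywhere.
[cite: LiebWuPRL1968, statement (a)] -/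
theorem exists_isLiebWuGroundStateDensities (hU : 0 < U) (hQ : 0 < Q) (hQπ : Q ≤ π) :
    ∃ ρ σ : ℝ → ℝ, IsLiebWuGroundStateDensities U Q ρ σ ∧ ∀ Λ, 0 < σ Λ :=
  ⟨liebWuRhoAt U Q, liebWuSigmaAt U Q, isLiebWuDensities_liebWuRhoAt_liebWuSigmaAt hU hQ hQπ,
    liebWuSigmaAt_pos hU hQ⟩

/-- **The Lieb–Wu energy at cutoff `Q` is a value of `IsLiebWuEnergyAt`** at the filling of the
constructed solution. [cite: LiebWuPRL1968, eqs. (15), (17)] -/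
theorem isLiebWuEnergyAt_liebWuRhoAt (hU : 0 < U) (hQ : 0 < Q) (hQπ : Q ≤ π) :
    IsLiebWuEnergyAt U (liebWuFilling Q (liebWuRhoAt U Q)) (liebWuEnergyPerSite Q (liebWuRhoAt U Q)) :=
  ⟨Q, liebWuRhoAt U Q, liebWuSigmaAt U Q, isLiebWuDensities_liebWuRhoAt_liebWuSigmaAt hU hQ hQπ, rfl, rfl⟩

/-- **Every `B = ∞` solution is the Neumann-series solution** (`σ`-part): uniqueness (Theorem 1) applied
to the constructed solution. [cite: LiebWuPhysicaA2003, §5, Theorem 1] -/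
theorem IsLiebWuDensities.sigma_eq_liebWuSigmaAt {ρ σ : ℝ → ℝ} (hU : 0 < U)
    (h : IsLiebWuDensities U Q univ ρ σ) : σ = liebWuSigmaAt U Q :=
  IsLiebWuDensities.sigma_unique hU h
    (isLiebWuDensities_liebWuRhoAt_liebWuSigmaAt hU h.cutoff_pos h.cutoff_le_pi)

/-- **Every `B = ∞` solution is the Neumann-series solution** (`ρ`-part, on `[-Q, Q]`).
[cite: LiebWuPhysicaA2003, §5, Theorem 1] -/
theorem IsLiebWuDensities.rho_eq_liebWuRhoAt {ρ σ : ℝ → ℝ} (hU : 0 < U)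
    (h : IsLiebWuDensities U Q univ ρ σ) {k : ℝ} (hk : k ∈ Icc (-Q) Q) : ρ k = liebWuRhoAt U Q k :=
  IsLiebWuDensities.rho_unique hU h
    (isLiebWuDensities_liebWuRhoAt_liebWuSigmaAt hU h.cutoff_pos h.cutoff_le_pi) hk

/-- The filling (15) and energy (17) of any `B = ∞` solution with cutoff `Q` are those of the Neumann-series
solution. [cite: LiebWuPhysicaA2003, §5, Theorem 1] -/
theorem IsLiebWuDensities.filling_energyPerSite_eq {ρ σ : ℝ → ℝ} (hU : 0 < U)
    (h : IsLiebWuDensities U Q univ ρ σ) :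
    liebWuFilling Q ρ = liebWuFilling Q (liebWuRhoAt U Q) ∧
      liebWuEnergyPerSite Q ρ = liebWuEnergyPerSite Q (liebWuRhoAt U Q) :=
  IsLiebWuDensities.filling_energyPerSite_unique hU h
    (isLiebWuDensities_liebWuRhoAt_liebWuSigmaAt hU h.cutoff_pos h.cutoff_le_pi)

/-- **Characterisation of the Lieb–Wu ground-state energies at `B = ∞`:** `e` is a Lieb–Wu energy at
filling `n` iff for some cutoff `0 < Q ≤ π` the Neumann-series solution has filling `n` and energy `e`.
(That `Q ↦` filling is a bijection onto `(0, 1]` is Lieb–Wu 2003, Lemma 4 / Theorem 3, not treated.)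
[cite: LiebWuPRL1968, statements (a)–(c)] -/
theorem isLiebWuEnergyAt_iff (hU : 0 < U) {n e : ℝ} :
    IsLiebWuEnergyAt U n e ↔ ∃ Q : ℝ, 0 < Q ∧ Q ≤ π ∧
      liebWuFilling Q (liebWuRhoAt U Q) = n ∧ liebWuEnergyPerSite Q (liebWuRhoAt U Q) = e := by
  constructor
  · rintro ⟨Q, ρ, σ, h, hn, he⟩
    obtain ⟨hf, hE⟩ := IsLiebWuDensities.filling_energyPerSite_eq hU h
    exact ⟨Q, h.cutoff_pos, h.cutoff_le_pi, hf ▸ hn, hE ▸ he⟩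
  · rintro ⟨Q, hQ, hQπ, hn, he⟩
    exact ⟨Q, liebWuRhoAt U Q, liebWuSigmaAt U Q,
      isLiebWuDensities_liebWuRhoAt_liebWuSigmaAt hU hQ hQπ, hn, he⟩

/-! ### Filling and energy as functions of the cutoff; agreement with the closed forms (18)–(20) at `Q = π` -/

/-- **The filling `N/N_a` (eq. (15)) of the `B = ∞` solution with momentum cutoff `Q`.**
[cite: LiebWuPRL1968, eq. (15)] -/
def liebWuFillingAtCutoff (U Q : ℝ) : ℝ := liebWuFilling Q (liebWuRhoAt U Q)

/-- **The energy per site (eq. (17)) of the `B = ∞` solution with momentum cutoff `Q`** — the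
Bethe-ansatz expression as printed; its identification with the Hubbard chain's ground-state energy
density at filling `liebWuFillingAtCutoff U Q` is Lieb–Wu's announcement and is not vendored here.
[cite: LiebWuPRL1968, eq. (17)] -/
def liebWuEnergyAtCutoff (U Q : ℝ) : ℝ := liebWuEnergyPerSite Q (liebWuRhoAt U Q)

/-- `IsLiebWuEnergyAt` in terms of the cutoff functions. [cite: LiebWuPRL1968, statements (a)–(c)] -/
theorem isLiebWuEnergyAt_iff_cutoff (hU : 0 < U) {n e : ℝ} :
    IsLiebWuEnergyAt U n e ↔
      ∃ Q : ℝ, 0 < Q ∧ Q ≤ π ∧ liebWuFillingAtCutoff U Q = n ∧ liebWuEnergyAtCutoff U Q = e :=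
  isLiebWuEnergyAt_iff hU

/-- **At `Q = π` the Neumann-series solution is the closed form (18):** `σ = σ₀` on `ℝ` (uniqueness,
Theorem 1, against the half-filled instance). [cite: LiebWuPRL1968, eq. (18)] -/
theorem liebWuSigmaAt_pi (hU : 0 < U) : liebWuSigmaAt U π = liebWuSigma0 U :=
  (IsLiebWuDensities.sigma_eq_liebWuSigmaAt hU (isLiebWuDensities_pi_liebWuRho0_liebWuSigma0 hU)).symm

/-- **At `Q = π` the Neumann-series solution is the closed form (19):** `ρ = ρ₀` on `[-π, π]`.
[cite: LiebWuPRL1968, eq. (19)] -/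
theorem liebWuRhoAt_pi (hU : 0 < U) {k : ℝ} (hk : k ∈ Icc (-π) π) :
    liebWuRhoAt U π k = liebWuRho0 U k :=
  (IsLiebWuDensities.rho_eq_liebWuRhoAt hU (isLiebWuDensities_pi_liebWuRho0_liebWuSigma0 hU) hk).symm

/-- **Statement (c) at `Q = π`: the filling is `1`.** [cite: LiebWuPRL1968, statement (c)] -/
theorem liebWuFillingAtCutoff_pi (hU : 0 < U) : liebWuFillingAtCutoff U π = 1 := by
  rw [liebWuFillingAtCutoff, ← liebWuFilling_pi_liebWuRho0 hU]
  exact ((IsLiebWuDensities.filling_energyPerSite_eq hU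
    (isLiebWuDensities_pi_liebWuRho0_liebWuSigma0 hU)).1).symm

/-- **Eq. (20): at `Q = π` the energy of the integral-equation solution is the closed form**
`liebWuEnergy U = -4∫₀^∞ J₀(ω)J₁(ω)/(ω(1 + e^{ωU/2})) dω`. [cite: LiebWuPRL1968, eq. (20)] -/
theorem liebWuEnergyAtCutoff_pi (hU : 0 < U) : liebWuEnergyAtCutoff U π = liebWuEnergy U := by
  rw [liebWuEnergyAtCutoff, ← liebWuEnergyPerSite_pi_liebWuRho0 hU]
  exact ((IsLiebWuDensities.filling_energyPerSite_eq hU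
    (isLiebWuDensities_pi_liebWuRho0_liebWuSigma0 hU)).2).symm

end Existence

end Literature.MathematicalPhysics.QuantumLattice

end
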